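import Literature.AlgebraicGeometry.CossartJannsenSaito2020.BlowupTowerLocalize
import Mathlib.AlgebraicGeometry.Geometrically.Reduced
import HarnessLib

/-!
# [OURS · L1 W4.2] K2-sep ROUTE A, brick (δ3, first part): **reduced centres pull back to reduced centres along FLAT GEOMETRICALLY REDUCED
# morphisms**, and the comparison maps `ι_n : S_n → X_n` of res-type-053's tower base change `T.bcData ι₀` are flat and geometrically reduced
# when `ι₀` is (e.g. `ι₀ = X_0 ×_k K → X_0` for `K/k` separable algebraic) — so `S_{n+1} → S_n` is the blow-up of `S_n` in the REDUCED
# preimage `ι_n⁻¹(C_n)`, i.e. the base change is again a `BlowupTower` (the packaging itself is left to the assembly, as a term)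
# (crux `SigmaMaxModifications` stmt-ResolutionOfSingularities-18506 / conjunct stmt-…-19249; line `w_ladder_rows` v8.5, registered stub
# `stub_isoSepRecurrent`; res-L1-w42-plan-1 WORD 2026-08-27T16:25:47Z; design `L/res-L1-w42-stub-2/k2sep/K2SEP-DESIGN.md` §8 (δ3))

Prover res-L1-w42-stub-2 (gen 5). Helper file `--supports stmt-ResolutionOfSingularities-19249 --as helper`; no definitions, no named fact. OURS
(cell res-hironaka, slot W4.2); NOT statements of [Hironaka2017] nor of [CossartJannsenSaito2020]. AI-written; AI review is weaker than expert
review. res-type-053's `comap_vanishingIdeal_eq_of_flat_of_isPreimmersion` / `BlowupTower.baseChange` need a flat PREIMMERSION; a ground-field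
extension is not one, but it is flat and geometrically reduced, which is what the reducedness of `V(C) ×_X S` really uses (Mathlib
`GeometricallyReduced.isReduced_of_flat_of_isLocallyNoetherian`).

* **`comap_vanishingIdeal_eq_of_flat_of_geometricallyReduced`** — `𝓘_C · 𝒪_S = 𝓘_{ι⁻¹(C)}` for `ι : S → X` flat and geometrically reduced,
  `X` locally noetherian, `C ⊆ X` closed (reduced structure).
* `BlowupTower.geometricallyReduced_bcι` — every `ι_n` is geometrically reduced when `ι₀` is.
* **`BlowupTower.isBlowup_bcπ_vanishingIdeal_preimage`** — `S_{n+1} → S_n` is the blow-up of `S_n` in `ι_n⁻¹(C_n)` (reduced), for `ι₀` flat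
  and geometrically reduced.

[OURS · L1 W4.2; AI-written] [cite: GortzWedhorn2020, Prop. 13.91 (2)] [cite: CossartJannsenSaito2020, p. 107]
-/

set_option linter.dupNamespace false

noncomputable section

open CategoryTheory CategoryTheory.Limits AlgebraicGeometry TopologicalSpace
open Literature.AlgebraicGeometry.Resolution Literature.AlgebraicGeometry.CossartJannsenSaito2020
open Scheme.IdealSheafData

namespace Summit.ResolutionOfSingularities.ResolutionOfSingularities.Theorems.SigmaMaxModificationsCorridor3.IsoTailsHS

universe u

/-- **`𝓘_C · 𝒪_S = 𝓘_{ι⁻¹(C)}`** for `ι : S ⟶ X` FLAT and GEOMETRICALLY REDUCED (`X` locally noetherian) and a closed `C ⊆ X` with its reduced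
structure: `V(𝓘_C · 𝒪_S) ≅ V(C) ×_X S` is reduced (Mathlib: flat geometrically reduced base change of the reduced noetherian `V(C)`), so the
pulled-back ideal is radical with support `ι⁻¹(C)` (res-type-053's `comap_vanishingIdeal_eq_of_flat_of_isPreimmersion` with the preimmersion
hypothesis replaced). [cite: GortzWedhorn2020, Prop. 13.91 (2)] -/
theorem comap_vanishingIdeal_eq_of_flat_of_geometricallyReduced {S X : Scheme.{u}} (ι : S ⟶ X) [Flat ι] [GeometricallyReduced ι]
    [IsLocallyNoetherian X] (C : Closeds X) :
    (vanishingIdeal C).comap ι = vanishingIdeal (C.preimage ι.continuous) := by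
  set J : X.IdealSheafData := vanishingIdeal C with hJ
  have hred : IsReduced (J.comap ι).subscheme := by
    haveI : IsReduced J.subscheme := isReduced_subscheme_vanishingIdeal C
    haveI : IsLocallyNoetherian J.subscheme := LocallyOfFiniteType.isLocallyNoetherian J.subschemeι
    haveI : IsReduced (pullback ι J.subschemeι) :=
      GeometricallyReduced.isReduced_of_flat_of_isLocallyNoetherian (pullback.snd ι J.subschemeι)
    exact isReduced_of_isOpenImmersion (J.comapIso ι).hom
  have hrad : (J.comap ι).radical = J.comap ι := (isReduced_subscheme_iff_radical_eq _).mp hred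
  refine (eq_vanishingIdeal_support hrad).trans ?_
  congr 1
  ext1
  rw [support_comap, Closeds.coe_preimage, Closeds.coe_preimage, hJ, coe_support_vanishingIdeal]

namespace BlowupTower

variable (T : BlowupTower.{u}) {S₀ : Scheme.{u}} (ι₀ : S₀ ⟶ T.X 0)

/-- Every comparison map `ι_n : S_n ⟶ X_n` of the base change `T.bcData ι₀` is geometrically reduced when `ι₀` is (stable under base change).
[cite: GortzWedhorn2020, Prop. 13.91 (2)] -/
theorem geometricallyReduced_bcι [GeometricallyReduced ι₀] : ∀ n, GeometricallyReduced (T.bcι ι₀ n)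
  | 0 => ‹GeometricallyReduced ι₀›
  | n + 1 => by
    haveI := geometricallyReduced_bcι n
    exact inferInstanceAs (GeometricallyReduced (pullback.fst (T.π n) (T.bcι ι₀ n)))

/-- **`S_{n+1} → S_n` is the blow-up of `S_n` in the REDUCED preimage `ι_n⁻¹(C_n)`** for `ι₀` flat and geometrically reduced
(`IsBlowup.of_isPullback_of_flat` + `comap_vanishingIdeal_eq_of_flat_of_geometricallyReduced`): the `isBlowup` field of the base-changed
`BlowupTower` with centres `ι_n⁻¹(C_n)`. [cite: GortzWedhorn2020, Prop. 13.91 (2)] [cite: CossartJannsenSaito2020, p. 107] -/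
theorem isBlowup_bcπ_vanishingIdeal_preimage [Flat ι₀] [GeometricallyReduced ι₀] (n : ℕ) :
    IsBlowup (T.bcπ ι₀ n) (vanishingIdeal ⟨(T.bcι ι₀ n).base ⁻¹' T.C n,
      by haveI := T.ln n; exact (T.isClosed_C n).preimage (T.bcι ι₀ n).continuous⟩) := by
  haveI := T.ln n
  haveI := T.flat_bcι ι₀ n
  haveI := BlowupTower.geometricallyReduced_bcι T ι₀ n
  have h := (T.isBlowup n).of_isPullback_of_flat (T.bc_isPullback ι₀ n)
  rw [comap_vanishingIdeal_eq_of_flat_of_geometricallyReduced] at h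
  exact h

end BlowupTower

end Summit.ResolutionOfSingularities.ResolutionOfSingularities.Theorems.SigmaMaxModificationsCorridor3.IsoTailsHS

end
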